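import Literature.NumberTheory.Automorphic.ShimuraCurveRibetTakahashi
import Literature.NumberTheory.EllipticCurves.NewformPeterssonSizeSymmSquareConverseProofs
import HarnessLib

/-!
# `‖f‖² ≪ N (log N)ᵏ` is exactly an upper bound `≪ (log N)ᵏ` for the symmetric square at the
# edge — the named fact `murty_petersson_newform_upper_bound` (`k = 1`) and what its printed proof
# establishes (`k = 3`), reduced in the tree

Topic `NumberTheory/Automorphic`; a proofs-only companion (theorems only: no definition, no named
fact) of `ShimuraCurveRibetTakahashi.lean`, for its named fact
`murty_petersson_newform_upper_bound` on the Petersson norm of the newform `f ∈ S₂(Γ₀(N))` of an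
elliptic curve over `ℚ`: `Re (f,f) ≤ C · N · log N` (Murty 1999, §2: "`(f,f) ≤ c₂ N log N`";
Pasten 2024, p. 49: "`‖f‖² ≪ N log N`").

The printed argument (Murty 1999, §2, "as in Mai–Murty [MM]"; Mai–Murty 1994, §2) has two steps:
(RS) the Rankin–Selberg identity expressing `(f, f)/N` as the value at the edge of convergence of
the symmetric-square Euler product, times bounded local factors; (PL) an upper bound for that
value by Rademacher's Phragmén–Lindelöf theorem, from the analytic continuation and functional
equation of `L(s, Sym² f)` (Shimura 1975). (RS) is PROVED in the tree:
`IsNewform0.tendsto_tprod_symmSq` (`NewformPeterssonSizeSymmSquareProofs.lean`) — as `w → 2⁺`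
the naive good-prime product `∏_{p ∤ N} ((1 − p^{1−w})(1 − (a_p² − 2p)p^{−w} + p^{2−2w}))⁻¹`
tends to `(8π³/N) · ∏_{p ∥ N}(1 − p⁻²) · Re (f,f)`. As for (PL), the SOURCE DISAGREES WITH THE
FACT ON THE EXPONENT: Murty 1999 prints "`L(2, sym²(f)) = O(log N)`", but the paper he cites for
it, Mai–Murty 1994, §2, prints "`L(1, Sym²(f)) = O((log N)³)`" (Rademacher's bound for a
degree-`3` Euler product with conductor `A`, `log A = O(log N)`), whence `(f,f) ≪ N (log N)³` only;
`log³` of the conductor is the convexity-strength bound at `s = 1` for a degree-`3` `L`-function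
with the Ramanujan bound (X. Li, IMRN 2010, introduction), and the `log N` bound is not known to be
proved anywhere. This file performs the deduction "(PL) ⟹ bound" in the tree for every exponent
`k` and shows it loses nothing, so that each statement is pinned to its exact analytic input:

* `IsNewformOf.peterssonProduct_re_le_of_symmSq_le` — if every limit of the naive product at
  `w → 2⁺` is `≤ M`, then `Re (f,f) ≤ N · M/(4π³)` (the local factor `∏_{p ∥ N}(1 − p⁻²)` lies in
  `[1/2, 1]`: the tree's `half_le_prod_primeFactors_filter_one_sub_inv_sq`,
  `prod_primeFactors_filter_one_sub_inv_sq_le_one`); and conversely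
  `IsNewformOf.symmSq_le_of_peterssonProduct_re_le`;
* `peterssonProduct_re_le_log_pow_iff_symmSq` — for every `k`, "`Re (f,f) ≤ C N (log N)ᵏ`
  uniformly over elliptic curves over `ℚ`" is EQUIVALENT to "every edge limit is `≤ C (log N)ᵏ`";
  `peterssonProduct_re_le_log_pow_iff_symmSqLOne` — the same with the tree's defined naive edge
  value `symmSqLOne f` (`CuspFormSymmSquareLSeries.lean`, `= 8π³ Re(f,f)/N` by `symmSqLOne_eq`);
  `peterssonProduct_re_le_log_pow_mono` — monotonicity in `k ≥ 1`;
* `murty_petersson_newform_upper_bound_iff_symmSq`, `…_iff_symmSqLOne` (`k = 1`) — the named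
  fact is equivalent to `L^{naive}(Sym² f_E, 1) ≪ log N_E`;
* `peterssonProduct_re_le_log_pow_three_of_symmSq_upper_bound` (`k = 3`) — the statement the
  printed proof establishes, `∃ C, Re (f,f) ≤ C N (log N)³`, from the printed (PL) input; and
  `peterssonProduct_re_le_log_pow_three_of_murty` — it is implied by the named fact. (It is not
  vendored as a separate named fact here: no declaration consumes the upper bound yet, and
  Pasten's use of it, `2 log ‖f‖ ≤ log N + O(log log N)` (p. 49), follows from either exponent.)

So the remaining content is (PL) alone: the analytic continuation and functional equation of
`L(s, Sym² f)` for arbitrary level (Shimura 1975; Gelbart–Jacquet 1978) and the Phragmén–Lindelöf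
bound at `s = 1` — none of which has a carrier in Mathlib or `Literature` yet — with exponent `3`;
with exponent `1` it is an open problem as far as the cited literature goes.

## References

* [MaiMurty1994] L. Mai, M. R. Murty, *The Phragmén–Lindelöf theorem and modular elliptic
  curves*, Contemp. Math. 166 (1994) 335–340, §2 (read in the authors' DVI preprint: Rademacher's
  Proposition; "`L(1, Sym²(f)) = O((log N)³)`"; the Rankin–Selberg display; Proposition
  "`log⟨f,f⟩ = O(log N)`").
* [MurtyCongruencePrimes1999] M. R. Murty, *Bounds for congruence primes*, Proc. Sympos. Pure
  Math. 66.1 (1999), §2 (read in the author's DVI preprint: "`L(2, sym²(f)) = O(log N)`. Hence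
  `(f,f) ≤ c₂ N log N`", citing [MM]).
* [PastenShimura2024] H. Pasten, J. Number Theory 254 (2024) = arXiv:1705.09251, §16 p. 49 (read).
* [Shimura1975] G. Shimura, Proc. London Math. Soc. 31 (1975); [GelbartJacquet1978].
-/

noncomputable section

open scoped Real Topology
open Filter CongruenceSubgroup

namespace Literature.NumberTheory.Automorphic

open Literature.NumberTheory.EllipticCurves.ModularForms

/-! ### From a bound at the edge to a bound for `(f, f)`, and back -/

section Reduction

variable {N : ℕ} [NeZero N] {W : WeierstrassCurve ℚ} {f : CuspForm (Gamma0 N) 2}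

/-- **An upper bound for the symmetric square at the edge bounds the Petersson norm.** If every
limit at `w → 2⁺` of the naive good-prime symmetric-square Euler product of the newform `f` of an
elliptic curve over `ℚ` (level `N`) is `≤ M`, then `Re (f, f)_{Γ₀(N)} ≤ N · M/(4π³)`: by
`IsNewform0.tendsto_tprod_symmSq` the limit is `(8π³/N) ∏_{p ∥ N}(1 − p⁻²) Re(f,f)` and
`∏_{p ∥ N}(1 − p⁻²) ≥ 1/2`. This is the deduction "`L(1, Sym² f) = O(·)` ⟹ `⟨f,f⟩ ≪ N · O(·)`"
of Mai–Murty 1994, §2, performed in the tree's normalisations. [cite: MaiMurty1994, §2 (Rankin–Selberg display and Proposition)] -/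
theorem _root_.Literature.NumberTheory.EllipticCurves.ModularForms.IsNewformOf.peterssonProduct_re_le_of_symmSq_le
    (hf : IsNewformOf W f) {M : ℝ}
    (hM : ∀ L : ℝ,
      Tendsto (fun w : ℝ ↦ ∏' p : Nat.Primes, (if (p : ℕ) ∣ N then (1 : ℝ) else
        ((1 - p * (p : ℝ) ^ (-w)) *
          (1 - (‖cuspCoeff f p‖ ^ 2 - 2 * p) * (p : ℝ) ^ (-w) + (p : ℝ) ^ 2 * ((p : ℝ) ^ (-w)) ^ 2))⁻¹))
        (𝓝[>] 2) (𝓝 L) → L ≤ M) :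
    (peterssonProduct (Gamma0 N) 2 f f).re ≤ N * M / (4 * π ^ 3) := by
  set R : ℝ := (peterssonProduct (Gamma0 N) 2 f f).re with hR
  set B : ℝ := ∏ p ∈ N.primeFactors with ¬ p ^ 2 ∣ N, (1 - ((p : ℝ) ^ 2)⁻¹) with hB
  have hNpos : (0 : ℝ) < N := by exact_mod_cast NeZero.pos N
  have hL₀ : 8 * π ^ 3 / N * B * R ≤ M := hM _ hf.1.tendsto_tprod_symmSq
  have hR0 : 0 ≤ R := hf.peterssonProduct_re_pos.le
  have hBhalf : 1 / 2 ≤ B := half_le_prod_primeFactors_filter_one_sub_inv_sq N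
  have hBpos : 0 < B := lt_of_lt_of_le (by norm_num) hBhalf
  have hM0 : 0 ≤ M := le_trans (by positivity) hL₀
  calc R = (N / (8 * π ^ 3 * B)) * (8 * π ^ 3 / N * B * R) := by field_simp
    _ ≤ (N / (8 * π ^ 3 * B)) * M := by gcongr
    _ ≤ (N / (8 * π ^ 3 * (1 / 2))) * M := by gcongr
    _ = N * M / (4 * π ^ 3) := by ring

/-- **Conversely, a bound for the Petersson norm bounds the edge value**: if
`Re (f, f)_{Γ₀(N)} ≤ R₀` then every limit at `w → 2⁺` of the naive symmetric-square product is
`≤ 8π³ R₀/N` (`∏_{p ∥ N}(1 − p⁻²) ≤ 1`, `Re (f,f) ≥ 0`). [cite: MaiMurty1994, §2 (Rankin–Selberg display)] -/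
theorem _root_.Literature.NumberTheory.EllipticCurves.ModularForms.IsNewformOf.symmSq_le_of_peterssonProduct_re_le
    (hf : IsNewformOf W f) {R₀ : ℝ} (hR₀ : (peterssonProduct (Gamma0 N) 2 f f).re ≤ R₀) {L : ℝ}
    (hL : Tendsto (fun w : ℝ ↦ ∏' p : Nat.Primes, (if (p : ℕ) ∣ N then (1 : ℝ) else
        ((1 - p * (p : ℝ) ^ (-w)) *
          (1 - (‖cuspCoeff f p‖ ^ 2 - 2 * p) * (p : ℝ) ^ (-w) + (p : ℝ) ^ 2 * ((p : ℝ) ^ (-w)) ^ 2))⁻¹))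
        (𝓝[>] 2) (𝓝 L)) :
    L ≤ 8 * π ^ 3 / N * R₀ := by
  set R : ℝ := (peterssonProduct (Gamma0 N) 2 f f).re with hR
  set B : ℝ := ∏ p ∈ N.primeFactors with ¬ p ^ 2 ∣ N, (1 - ((p : ℝ) ^ 2)⁻¹) with hB
  have hNpos : (0 : ℝ) < N := by exact_mod_cast NeZero.pos N
  have hLeq : L = 8 * π ^ 3 / N * B * R := tendsto_nhds_unique hL hf.1.tendsto_tprod_symmSq
  have hR0 : 0 ≤ R := hf.peterssonProduct_re_pos.le
  have hB1 : B ≤ 1 := prod_primeFactors_filter_one_sub_inv_sq_le_one N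
  have hB0 : 0 ≤ B := le_trans (by norm_num) (half_le_prod_primeFactors_filter_one_sub_inv_sq N)
  have h8 : 0 ≤ 8 * π ^ 3 / N := by positivity
  calc L = (8 * π ^ 3 / N) * (B * R) := by rw [hLeq]; ring
    _ ≤ (8 * π ^ 3 / N) * (1 * R) := by gcongr
    _ ≤ (8 * π ^ 3 / N) * (1 * R₀) := by gcongr
    _ = 8 * π ^ 3 / N * R₀ := by ring

end Reduction

/-! ### The named facts are exactly upper bounds for the symmetric square at the edge -/

section Facts

/-- **`‖f‖² ≪ N (log N)ᵏ` ⟺ the edge value is `≪ (log N)ᵏ`**, for every exponent `k`: there is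
`C` with `Re (f,f)_{Γ₀(N)} ≤ C N (log N)ᵏ` for all levels `N` and all newforms `f ∈ S₂(Γ₀(N))` of
elliptic curves over `ℚ` iff there is `C` such that every limit `L` at `w → 2⁺` of the naive
good-prime symmetric-square product of such an `f` satisfies `L ≤ C (log N)ᵏ`
("⇐": `peterssonProduct_re_le_of_symmSq_le`; "⇒": `symmSq_le_of_peterssonProduct_re_le`). The
printed cases: `k = 1` is Murty's sentence "By the Phragmén–Lindelöf theorem, we have
`L(2, sym²(f)) = O(log N)`. Hence `(f,f) ≤ c₂ N log N`" (Murty 1999, §2 — the named fact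
`murty_petersson_newform_upper_bound`, see `murty_petersson_newform_upper_bound_iff_symmSq`);
`k = 3` is what the source Murty cites for it actually proves: "by Rademacher's version of the
Phragmén–Lindelöf, `L(1, Sym²(f)) = O((log N)³)` … This yields Proposition. `log⟨f,f⟩ = O(log N)`"
(Mai–Murty 1994, §2). [cite: MaiMurty1994, §2 (Rademacher's Proposition; "L(1, Sym²(f)) = O((log N)³)"; Rankin–Selberg display)] -/
theorem peterssonProduct_re_le_log_pow_iff_symmSq (k : ℕ) :
    (∃ C : ℝ, ∀ (N : ℕ) [NeZero N] (W : WeierstrassCurve ℚ) [W.IsElliptic]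
        (f : CuspForm (Gamma0 N) 2), IsNewformOf W f →
          (peterssonProduct (Gamma0 N) 2 f f).re ≤ C * N * Real.log N ^ k) ↔
      ∃ C : ℝ, ∀ (N : ℕ) [NeZero N] (W : WeierstrassCurve ℚ) [W.IsElliptic]
        (f : CuspForm (Gamma0 N) 2), IsNewformOf W f → ∀ L : ℝ,
          Tendsto (fun w : ℝ ↦ ∏' p : Nat.Primes, (if (p : ℕ) ∣ N then (1 : ℝ) else
            ((1 - p * (p : ℝ) ^ (-w)) *
              (1 - (‖cuspCoeff f p‖ ^ 2 - 2 * p) * (p : ℝ) ^ (-w) +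
                (p : ℝ) ^ 2 * ((p : ℝ) ^ (-w)) ^ 2))⁻¹))
            (𝓝[>] 2) (𝓝 L) →
          L ≤ C * Real.log N ^ k := by
  constructor
  · rintro ⟨C, hC⟩
    refine ⟨8 * π ^ 3 * C, fun N _ W _ f hf L hL ↦ ?_⟩
    have hNpos : (0 : ℝ) < N := by exact_mod_cast NeZero.pos N
    calc L ≤ 8 * π ^ 3 / N * (C * N * Real.log N ^ k) :=
          hf.symmSq_le_of_peterssonProduct_re_le (hC N W f hf) hL
      _ = 8 * π ^ 3 * C * Real.log N ^ k := by field_simp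
  · rintro ⟨C, hC⟩
    refine ⟨C / (4 * π ^ 3), fun N _ W _ f hf ↦ ?_⟩
    calc (peterssonProduct (Gamma0 N) 2 f f).re ≤ N * (C * Real.log N ^ k) / (4 * π ^ 3) :=
          hf.peterssonProduct_re_le_of_symmSq_le (hC N W f hf)
      _ = C / (4 * π ^ 3) * N * Real.log N ^ k := by ring

/-- **`‖f‖² ≪ N (log N)ᵏ` ⟺ `L^{naive}(Sym² f, 1) ≪ (log N)ᵏ`** with the tree's DEFINED edge
value `symmSqLOne f = lim_{w→2⁺} Re L^{naive}(Sym² f, w)` (`CuspFormSymmSquareLSeries.lean`;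
Watkins' normalisation, centre `1/2`), which equals `8π³ Re(f,f)/N` for every `f ∈ S₂(Γ₀(N))`
(`symmSqLOne_eq`, Rankin's theorem in the tree): constants `8π³ C`, resp. `C/(8π³)`. With `k = 1`
this is literally Murty's "`L(2, sym²(f)) = O(log N)`" (arithmetic normalisation), with `k = 3`
Mai–Murty's "`L(1, Sym²(f)) = O((log N)³)`", for the naive series (which is the complete
`L(s, Sym² f)` exactly when `N` is squarefree). [cite: MaiMurty1994, §2 (Rankin–Selberg display)] -/
theorem peterssonProduct_re_le_log_pow_iff_symmSqLOne (k : ℕ) :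
    (∃ C : ℝ, ∀ (N : ℕ) [NeZero N] (W : WeierstrassCurve ℚ) [W.IsElliptic]
        (f : CuspForm (Gamma0 N) 2), IsNewformOf W f →
          (peterssonProduct (Gamma0 N) 2 f f).re ≤ C * N * Real.log N ^ k) ↔
      ∃ C : ℝ, ∀ (N : ℕ) [NeZero N] (W : WeierstrassCurve ℚ) [W.IsElliptic]
        (f : CuspForm (Gamma0 N) 2), IsNewformOf W f → symmSqLOne f ≤ C * Real.log N ^ k := by
  constructor
  · rintro ⟨C, hC⟩
    refine ⟨8 * π ^ 3 * C, fun N _ W _ f hf ↦ ?_⟩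
    have hNpos : (0 : ℝ) < N := by exact_mod_cast NeZero.pos N
    have h := hC N W f hf
    rw [symmSqLOne_eq f, div_le_iff₀ hNpos]
    calc 8 * π ^ 3 * (peterssonProduct (Gamma0 N) 2 f f).re
        ≤ 8 * π ^ 3 * (C * N * Real.log N ^ k) := by gcongr
      _ = 8 * π ^ 3 * C * Real.log N ^ k * N := by ring
  · rintro ⟨C, hC⟩
    refine ⟨C / (8 * π ^ 3), fun N _ W _ f hf ↦ ?_⟩
    have hNpos : (0 : ℝ) < N := by exact_mod_cast NeZero.pos N
    have hπ : (0 : ℝ) < 8 * π ^ 3 := by positivity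
    have h := hC N W f hf
    rw [symmSqLOne_eq f, div_le_iff₀ hNpos] at h
    calc (peterssonProduct (Gamma0 N) 2 f f).re
        = 8 * π ^ 3 * (peterssonProduct (Gamma0 N) 2 f f).re / (8 * π ^ 3) := by field_simp
      _ ≤ C * Real.log N ^ k * N / (8 * π ^ 3) := by gcongr
      _ = C / (8 * π ^ 3) * N * Real.log N ^ k := by ring

/-- **Monotonicity in the exponent**: for `1 ≤ j ≤ k`, `‖f‖² ≪ N (log N)ʲ` implies
`‖f‖² ≪ N (log N)ᵏ` (`(log N)ʲ ≤ (log N)ᵏ/(log 2)^{k−j}` for `N ≥ 2`; at `N = 1` both bounds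
vanish because `j, k ≥ 1`). [folklore] -/
theorem peterssonProduct_re_le_log_pow_mono {j k : ℕ} (hj : 1 ≤ j) (hjk : j ≤ k)
    (h : ∃ C : ℝ, ∀ (N : ℕ) [NeZero N] (W : WeierstrassCurve ℚ) [W.IsElliptic]
        (f : CuspForm (Gamma0 N) 2), IsNewformOf W f →
          (peterssonProduct (Gamma0 N) 2 f f).re ≤ C * N * Real.log N ^ j) :
    ∃ C : ℝ, ∀ (N : ℕ) [NeZero N] (W : WeierstrassCurve ℚ) [W.IsElliptic]
        (f : CuspForm (Gamma0 N) 2), IsNewformOf W f →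
          (peterssonProduct (Gamma0 N) 2 f f).re ≤ C * N * Real.log N ^ k := by
  obtain ⟨C, hC⟩ := h
  obtain ⟨d, rfl⟩ := Nat.exists_eq_add_of_le hjk
  refine ⟨max C 0 / Real.log 2 ^ d, fun N _ W _ f hf ↦ ?_⟩
  have hR := hC N W f hf
  have hlog2 : 0 < Real.log 2 := Real.log_pos (by norm_num)
  rcases (NeZero.one_le : 1 ≤ N).eq_or_lt with h1 | h2
  · -- `N = 1`: both bounds vanish (`j ≥ 1`)
    subst h1
    have hj0 : j ≠ 0 := by omega
    have hk0 : j + d ≠ 0 := by omega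
    simp only [Nat.cast_one, Real.log_one, zero_pow hj0, mul_zero] at hR
    simpa only [Nat.cast_one, Real.log_one, zero_pow hk0, mul_zero] using hR
  · have hN2 : (2 : ℝ) ≤ N := by exact_mod_cast h2
    have hlogN : Real.log 2 ≤ Real.log N := Real.log_le_log (by norm_num) hN2
    have hlogN0 : 0 ≤ Real.log N := hlog2.le.trans hlogN
    have hNpos : (0 : ℝ) ≤ N := by positivity
    have hq : 1 ≤ (Real.log N / Real.log 2) ^ d :=
      one_le_pow₀ (by rwa [le_div_iff₀ hlog2, one_mul])
    calc (peterssonProduct (Gamma0 N) 2 f f).re ≤ C * N * Real.log N ^ j := hR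
      _ ≤ max C 0 * N * Real.log N ^ j * 1 := by
          rw [mul_one]; gcongr; exact le_max_left _ _
      _ ≤ max C 0 * N * Real.log N ^ j * (Real.log N / Real.log 2) ^ d := by gcongr
      _ = max C 0 / Real.log 2 ^ d * N * Real.log N ^ (j + d) := by
          rw [div_pow]
          field_simp
          ring

/-- **`murty_petersson_newform_upper_bound` ⟺ "`L(1, Sym² f_E) ≪ log N_E`" for the naive
good-prime product at the edge** (the case `k = 1` of `peterssonProduct_re_le_log_pow_iff_symmSq`).
The fact `Re (f,f) ≤ C N log N` (Murty 1999, §2; Pasten 2024, p. 49) holds iff there is `C` such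
that for every level `N`, every elliptic `W/ℚ` with newform `f ∈ S₂(Γ₀(N))` and every limit `L`
at `w → 2⁺` of the naive symmetric-square product, `L ≤ C log N`. This right-hand side is Murty's
sentence "By the Phragmén–Lindelöf theorem, we have `L(2, sym²(f)) = O(log N)`" — which the
source cited for it (Mai–Murty 1994, §2) proves with `(log N)³`, not `log N`. [cite: MurtyCongruencePrimes1999, §2 ("L(2, sym² f) = O(log N). Hence (f,f) ≤ c₂ N log N")] -/
theorem murty_petersson_newform_upper_bound_iff_symmSq :
    murty_petersson_newform_upper_bound ↔
      ∃ C : ℝ, ∀ (N : ℕ) [NeZero N] (W : WeierstrassCurve ℚ) [W.IsElliptic]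
        (f : CuspForm (Gamma0 N) 2), IsNewformOf W f → ∀ L : ℝ,
          Tendsto (fun w : ℝ ↦ ∏' p : Nat.Primes, (if (p : ℕ) ∣ N then (1 : ℝ) else
            ((1 - p * (p : ℝ) ^ (-w)) *
              (1 - (‖cuspCoeff f p‖ ^ 2 - 2 * p) * (p : ℝ) ^ (-w) +
                (p : ℝ) ^ 2 * ((p : ℝ) ^ (-w)) ^ 2))⁻¹))
            (𝓝[>] 2) (𝓝 L) →
          L ≤ C * Real.log N := by
  have h := peterssonProduct_re_le_log_pow_iff_symmSq 1
  simp only [pow_one] at h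
  exact h

/-- **`murty_petersson_newform_upper_bound` ⟺ `L^{naive}(Sym² f_E, 1) ≪ log N_E`**, with the
tree's defined edge value `symmSqLOne` (Watkins' normalisation; `= 8π³ Re(f,f)/N`,
`symmSqLOne_eq`): the named fact is literally the statement "`symmSqLOne f ≤ C log N` for the
newforms of all elliptic curves over `ℚ`" — Murty's sentence "`L(2, sym²(f)) = O(log N)`"
(Murty 1999, §2), whose cited source proves `O((log N)³)` (Mai–Murty 1994, §2). [cite: MurtyCongruencePrimes1999, §2 ("L(2, sym² f) = O(log N)")] -/
theorem murty_petersson_newform_upper_bound_iff_symmSqLOne :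
    murty_petersson_newform_upper_bound ↔
      ∃ C : ℝ, ∀ (N : ℕ) [NeZero N] (W : WeierstrassCurve ℚ) [W.IsElliptic]
        (f : CuspForm (Gamma0 N) 2), IsNewformOf W f → symmSqLOne f ≤ C * Real.log N := by
  have h := peterssonProduct_re_le_log_pow_iff_symmSqLOne 1
  simp only [pow_one] at h
  exact h

/-- **`murty_petersson_newform_upper_bound` from its printed (claimed) input**: if the naive
symmetric-square product of the newform of every elliptic curve over `ℚ` has edge value
`≤ C log N`, the fact holds (with constant `C/(4π³)`). [cite: MurtyCongruencePrimes1999, §2] -/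
theorem murty_petersson_newform_upper_bound_of_symmSq_upper_bound
    (h : ∃ C : ℝ, ∀ (N : ℕ) [NeZero N] (W : WeierstrassCurve ℚ) [W.IsElliptic]
        (f : CuspForm (Gamma0 N) 2), IsNewformOf W f → ∀ L : ℝ,
          Tendsto (fun w : ℝ ↦ ∏' p : Nat.Primes, (if (p : ℕ) ∣ N then (1 : ℝ) else
            ((1 - p * (p : ℝ) ^ (-w)) *
              (1 - (‖cuspCoeff f p‖ ^ 2 - 2 * p) * (p : ℝ) ^ (-w) +
                (p : ℝ) ^ 2 * ((p : ℝ) ^ (-w)) ^ 2))⁻¹))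
            (𝓝[>] 2) (𝓝 L) →
          L ≤ C * Real.log N) :
    murty_petersson_newform_upper_bound :=
  murty_petersson_newform_upper_bound_iff_symmSq.mpr h

/-- **What the printed proof establishes: `‖f‖² ≪ N (log N)³` from the Phragmén–Lindelöf input
`L(1, Sym² f) = O((log N)³)`** (Mai–Murty 1994, §2), stated for the naive good-prime product at
the edge (the case `k = 3` of `peterssonProduct_re_le_log_pow_iff_symmSq`, direction "⇐"). The
conclusion is the corrected rendering of `murty_petersson_newform_upper_bound` recorded in its
docstring caveat. [cite: MaiMurty1994, §2 ("L(1, Sym²(f)) = O((log N)³)" and Proposition)] -/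
theorem peterssonProduct_re_le_log_pow_three_of_symmSq_upper_bound
    (h : ∃ C : ℝ, ∀ (N : ℕ) [NeZero N] (W : WeierstrassCurve ℚ) [W.IsElliptic]
        (f : CuspForm (Gamma0 N) 2), IsNewformOf W f → ∀ L : ℝ,
          Tendsto (fun w : ℝ ↦ ∏' p : Nat.Primes, (if (p : ℕ) ∣ N then (1 : ℝ) else
            ((1 - p * (p : ℝ) ^ (-w)) *
              (1 - (‖cuspCoeff f p‖ ^ 2 - 2 * p) * (p : ℝ) ^ (-w) +
                (p : ℝ) ^ 2 * ((p : ℝ) ^ (-w)) ^ 2))⁻¹))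
            (𝓝[>] 2) (𝓝 L) →
          L ≤ C * Real.log N ^ 3) :
    ∃ C : ℝ, ∀ (N : ℕ) [NeZero N] (W : WeierstrassCurve ℚ) [W.IsElliptic]
        (f : CuspForm (Gamma0 N) 2), IsNewformOf W f →
          (peterssonProduct (Gamma0 N) 2 f f).re ≤ C * N * Real.log N ^ 3 :=
  (peterssonProduct_re_le_log_pow_iff_symmSq 3).mpr h

/-- **The corrected statement is the weaker one**: `murty_petersson_newform_upper_bound`
(`‖f‖² ≪ N log N`) implies `‖f‖² ≪ N (log N)³` (`peterssonProduct_re_le_log_pow_mono` with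
`j = 1`, `k = 3`). [folklore] -/
theorem peterssonProduct_re_le_log_pow_three_of_murty (h : murty_petersson_newform_upper_bound) :
    ∃ C : ℝ, ∀ (N : ℕ) [NeZero N] (W : WeierstrassCurve ℚ) [W.IsElliptic]
        (f : CuspForm (Gamma0 N) 2), IsNewformOf W f →
          (peterssonProduct (Gamma0 N) 2 f f).re ≤ C * N * Real.log N ^ 3 := by
  refine peterssonProduct_re_le_log_pow_mono (j := 1) le_rfl (by norm_num) ?_
  obtain ⟨C, hC⟩ := h
  exact ⟨C, fun N _ W _ f hf ↦ by simpa only [pow_one] using hC N W f hf⟩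

end Facts

end Literature.NumberTheory.Automorphic

end
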